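import Literature.MathematicalPhysics.QuantumFieldTheory.Balaban1983to89.Node00.Record13DatumKey

/-!
# NODE 00 (YM-PLAN Track A) — THE STAGE-13 DATUM ∕ RECORD KEYS RE-KEYED ON THE GUARDED PROVISOS OF RECORD `Stage13Params.Provisos₁₃Sep` (def-T `Node00/Record13` v1.2 §9):
# `IsDatumOfRecord₁₃CSep` (+ `.params ∕ .provisos`, `canon₁₃Sep`, `IsRateKey₁₃Sep`), the regime keys `IsDatumOfRecord₁₃CSepOn ∕ IsRecordOfRecord₁₃CSepOn ∕ canon₁₃SepOn`,
# the CN keys at the guard of record `IsDatumOfRecord₁₃CSepN ∕ IsRecordOfRecord₁₃CSepN`, and the one-way bridges from the v1.1-keyed classes (§8)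

NODE 00 RECORD MODULE (cell `pub-ymgap`, seat `pub-ymgap-node00-def-RR-2` gen 9 = second reader ∕ key + instance side of the RATE-RECORD HOME, director-ym R141 (A);
dag-lead TABLE v36 «datum-KEY ⁗ twin leaf = RR-2 lineage, one declarer»).  THE ⁗ TWIN of this seat's `Node00/Record13DatumKey` (the Stage-13 datum ∕ record keys over
`Stage13Params.Provisos₁₃`, v1.1 of def-T's `Node00/Record13`), RE-KEYED on the successor proviso predicate of `Node00/Record13` v1.2 §9.  WHY A TWIN (director-ym LINES
№136–№138, plan ACK-138, dag-lead WORDS-139 ∕ WORDS-140): the tenth displayed row `bg` of `Provisos₁₃` ranged over EVERY sequence `s` of the regular support; the row of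
record is now GUARDED — `Provisos₁₃Sep.bg : ∀ p n, n ≤ p.K → Step.InInterval θ.γ n (gOfRecord₁₃ F N θ p) → PartCompat₁₃ F N θ p n → BgProvisoΛ … (suppOfRecord₁₃Sep F N θ p n) …`
(background-field bound only over `Sect2.SeqSeparated` sequences — [II] (2.18) — and under the run-level partition compatibility `PartCompat₁₃` — [III] p.257); the gate
refuses an in-place body change of a landed structure, so def-T DEPRECATED `Provisos₁₃` and ADDED `Provisos₁₃Sep` with the twins `towerOfRecord₁₃Sep ∕ datumOfRecord₁₃Sep ∕
IsRecordOfRecord₁₃CSep ∕ …` (every v1.1 body under the token map), and the route's Stage-13 items are re-filed (rev 18) with the token map `Provisos₁₃ ↦ Provisos₁₃Sep`,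
`datumOfRecord₁₃ ↦ datumOfRecord₁₃Sep` and NOTHING else.  This module is the same token map applied to `Node00/Record13DatumKey`: EVERY declaration below is the v1.1-keyed
declaration with `Provisos₁₃ ↦ Provisos₁₃Sep`, `datumOfRecord₁₃ ↦ datumOfRecord₁₃Sep`, `IsRecordOfRecord₁₃C… ↦ IsRecordOfRecord₁₃CSep…` in its statement and proof, under the
NAME RULE «def-T's suffix `Sep` at def-T's position»: `IsDatumOfRecord₁₃C ↦ IsDatumOfRecord₁₃CSep`, `IsDatumOfRecord₁₃COn ↦ IsDatumOfRecord₁₃CSepOn`, `IsDatumOfRecord₁₃CN ↦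
IsDatumOfRecord₁₃CSepN`, `IsRecordOfRecord₁₃COn ∕ CN ↦ IsRecordOfRecord₁₃CSepOn ∕ CSepN`, `canon₁₃ ↦ canon₁₃Sep`, `canon₁₃On ↦ canon₁₃SepOn`, `IsRateKey₁₃ ↦ IsRateKey₁₃Sep`,
the theorem stems likewise (`isDatumOfRecord₁₃CSep_datumOfRecord₁₃Sep`, `exists_keyed_canon₁₃Sep_iff`, `keyed_canon₁₃SepOn_coherent`, `forall_isRecordOfRecord₁₃CSepN_iff`, …).
KEYED FLAT on `datumOfRecord₁₃Sep` (the token the rev-18 item texts carry; def-T's `datumOfRecord₁₃Sep_eq_core ∕ datumOfRecord₁₃Sep_toSep` (`rfl`) reach the bg-free core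
and the v1.1 datum).  APPEND-ONLY: a NEW leaf importing `Node00/Record13DatumKey` (hence `Node00/Record13` v1.2 and `Node00/Record12DatumKey`); NOTHING landed is edited —
`Node00/Record13DatumKey` (≥ 4 direct importers) stands VERBATIM as the v1.1-keyed («‴») key module.  CONSUMED BY NAME from def-T's v1.2 §9: `Stage13Params.Provisos₁₃Sep`,
`Stage13Params.Provisos₁₃.toSep`, `datumOfRecord₁₃Sep`, `IsRecordOfRecord₁₃CSep`, `exists_world_isRecordOfRecord₁₃CSep`, `exists_provisos_of_isRecordOfRecord₁₃CSep`,
`exists_isRecordOfRecord₅C_of_isRecordOfRecord₁₃CSep`, the `rfl` faces `βfun_ ∕ flow_g_ ∕ av_ ∕ isDatumOfRecord₀_datumOfRecord₁₃Sep`, `isPrintedAveraged_datumOfRecord₁₃Sep`;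
REUSED BY NAME from `Node00/Record13DatumKey` (θ-level, proviso-free — NOT twinned): the residual-assignment types and lifts `RateAssignment₁₃ ∕ SpineAssignment₁₃`
(`.ofStageFree ∕ .of₁₁ ∕ .of₁₂ ∕ .toStageFree`, `rateAssignment₁₃OfStageFree ∕ Of₁₁ ∕ Of₁₂`, `spineAssignment₁₃OfStageFree ∕ Of₁₁ ∕ Of₁₂`) and the guard of record
`unityNondeg₁₃ ∕ unityNondeg₁₃_iff`.  The key layer is PROVISO-FIELD-BLIND (no declaration here projects a field of `Provisos₁₃Sep`; the guarded `bg` row is read only by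
def-T's `norm_E_bg_le_stage13Sep` and its consumers), which is why the re-key is a token map and every proof term is the v1.1 proof term.

WHY THIS OBJECT (as at v1.1; said once more for the ⁗ reader).  The rate-record home and the spine-record home of clusters K4 ∕ K5 are read JOINTLY by the N19′ edge, so both
are keyed to ONE parameter per datum: THE CANONICAL PARAMETER `h.params := Classical.choose h` of `h : IsDatumOfRecord₁₃CSep F N D`, with `h.provisos : h.params.Provisos₁₃Sep F N`,
`h.admissible`, `h.eq_datumOfRecord₁₃Sep : D = datumOfRecord₁₃Sep F N h.params h.provisos`; every θ-level object of record then has ONE datum-level instance per `(F, D, g₀, os)`,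
records keyed «`∃ θ hP, θ.Admissible F N ∧ D = datumOfRecord₁₃Sep F N θ hP ∧ S = canon₁₃Sep F N cr θ hP g₀ os`» are COHERENT (`exists_keyed_canon₁₃Sep_iff`,
`keyed_canon₁₃Sep_coherent`), and a consumer proving its node at EVERY admissible tuple with (guarded) provisos proves it at the instance (`IsDatumOfRecord₁₃CSep.forall_params`).
`isDatumOfRecord₁₃CSep_iff_exists_world`: the datum class IS def-T's `IsRecordOfRecord₁₃CSep` with the world forgotten; «`∃ D w, IsRecordOfRecord₁₃CSep F N D w`» REDUCES
HONESTLY to «one admissible Stage-13 tuple with every field of `Provisos₁₃Sep` a theorem» (`exists_isDatumOfRecord₁₃CSep_iff_exists_params`) — INHABITATION IS NOT CLAIMED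
HERE.  `IsRateKey₁₃Sep F N D w θ` is `IsRecordOfRecord₁₃CSep`'s body with θ EXPOSED (`isRecordOfRecord₁₃CSep_iff_exists_isRateKey₁₃Sep`, `Iff.rfl`).  THE REGIME KEYS (§4–§6):
a reading that CONSUMES a regime `Rg : (F : T4Family) → Stage13Params F N → Prop` quantifies over `IsDatumOfRecord₁₃CSepOn F N Rg D` ∕ `IsRecordOfRecord₁₃CSepOn F N Rg D w`
(canonical parameter IN the regime, `h.regime`; junction `forall_isRecordOfRecord₁₃CSepOn_iff`; `canon₁₃SepOn Rg` with COHERENCE).  §7 instantiates the CN keys at the guard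
of record `unityNondeg₁₃ N F θ := θ.ZtUnity F N ∧ θ.SlotsNondegenerate₁₃ F N` with the literal faces `isDatumOfRecord₁₃CSepN_iff`, `exists_isDatumOfRecord₁₃CSepN_iff_exists_params`
(= the body «`∃ θ, θ.Provisos₁₃Sep F N ∧ (θ.ZtUnity F N ∧ θ.SlotsNondegenerate₁₃ F N) ∧ θ.Admissible F N`» the rev-18 inhabitation item reads at `(F, 2)`) and
`forall_isRecordOfRecord₁₃CSepN_iff` (= the guarded ∀-items' binder prefix `∀ (θ) (h : θ.Provisos₁₃Sep F N), (θ.ZtUnity F N ∧ θ.SlotsNondegenerate₁₃ F N) → θ.Admissible F N → …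
(datumOfRecord₁₃Sep F N θ h) …`).  At the trivial regime everything is the CSep key again (`isDatumOfRecord₁₃CSepOn_true_iff`, `isRecordOfRecord₁₃CSepOn_true_iff`).

§8 ONE-WAY BRIDGES ‴ → ⁗.  `Provisos₁₃ → Provisos₁₃Sep` IS a lemma (def-T's `Provisos₁₃.toSep`: the unguarded `bg` row implies the guarded one, the nine other rows verbatim)
and `datumOfRecord₁₃Sep F N θ hP.toSep = datumOfRecord₁₃ F N θ hP` definitionally, so every v1.1-keyed class implies its ⁗ twin AT THE SAME DATUM AND PARAMETER:
`IsRateKey₁₃.toSep`, `IsDatumOfRecord₁₃C.toSep`, `IsDatumOfRecord₁₃COn.toSep`, `IsRecordOfRecord₁₃COn.toSep`, `IsDatumOfRecord₁₃CN.toSep`, `IsRecordOfRecord₁₃CN.toSep`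
(the record-level `IsRecordOfRecord₁₃C.toSep` is def-T's).  Use: a ‴-keyed PRODUCER lands in the ⁗ key for free; a ⁗-keyed ∀-item is the WEAKER obligation only through its
`h : Provisos₁₃Sep` binder — NO converse bridge exists or can (`Provisos₁₃Sep → Provisos₁₃` would assert the background-field bound over non-separated sequences, which is
exactly what v1.2 stops displaying), and the canonical parameters `h.params` ∕ `h.toSep.params` of one datum under the two keys are NOT related by any lemma (two choices).

WHAT IS NOT HERE.  NO edit of `Node00/Record13DatumKey` or of any consumer; NO ⁗ → ‴ bridge; NO `₁₂ ↔ ₁₃` key bridge (as at v1.1); NO reading of the `bg` row; NO inhabitant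
of any key; the θ-level assignments and the guard of record are NOT re-declared (imported by name).

HONEST FRAMING.  Definitions of record + kernel bookkeeping (`Classical.choose`, `rfl`, `dite`, ∃-repackaging); NOTHING of Bałaban's is asserted; NO inhabitant of any key
is claimed (the record's rev-18 inhabitation item is OPEN); no node is discharged; counts unmoved (COUNT-NEUTRAL); one finite four-torus programme at fixed `ε` — NOT the
continuum limit on ℝ⁴, NOT infinite volume, NOT OS, NOT a mass gap, NOT the Clay problem.  No `sorry` ∕ `axiom` ∕ `opaque` ∕ `instance` ∕ `notation`.
[Balaban1989LargeFieldII] = Commun. Math. Phys. **122** (1989) 355–392; [Balaban1988Convergent] = Commun. Math. Phys. **119** (1988) 243–285 (p.257: partition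
compatibility); [Balaban1988RG2Cluster] = Commun. Math. Phys. **116** (1988) 1–22 ((2.18): separated sequences); [Balaban1987RG1] = Commun. Math. Phys. **109** (1987) 249–301.
-/

noncomputable section

namespace Literature.MathematicalPhysics.QuantumFieldTheory.Balaban1983to89.Node00

open T4Continuum AveragingRT T4FiniteEpsInhabited FlowStep FlowStepRuns DagBinding T4DatumAssembly

/-! ## §1. «`D` is a datum of record, Stage 13» and its CANONICAL parameter -/

section DatumKey

variable (F : T4Family) (N : ℕ) [NeZero N]

/-- **«`D` is a datum of record, Stage 13 (C-class)»**: SOME admissible Stage-13 parameter tuple satisfying its displayed provisos has `D` as its datum of record — the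
datum-level shadow of `IsRecordOfRecord₁₃CSep` (the world forgotten; `isDatumOfRecord₁₃CSep_iff_exists_world`). [cite: Balaban1989LargeFieldII, Thm 1 + (0.1) pp.355–356; Balaban1988Convergent, Thms 1–2 pp.262–263 (objects of record; bookkeeping)] -/
def IsDatumOfRecord₁₃CSep (D : FiniteEpsData F (SU N)) : Prop :=
  ∃ (θ : Stage13Params F N) (h : θ.Provisos₁₃Sep F N), θ.Admissible F N ∧ D = datumOfRecord₁₃Sep F N θ h

/-- Every admissible Stage-13 parameter tuple with provisos yields a datum of record. [cite: Balaban1989LargeFieldII, Thm 1 + (0.1) pp.355–356 (bookkeeping)] -/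
theorem isDatumOfRecord₁₃CSep_datumOfRecord₁₃Sep (θ : Stage13Params F N) (h : θ.Provisos₁₃Sep F N) (hθ : θ.Admissible F N) :
    IsDatumOfRecord₁₃CSep F N (datumOfRecord₁₃Sep F N θ h) :=
  ⟨θ, h, hθ, rfl⟩

/-- **K0′ READS THE SAME AT THE DATUM**: some datum of record exists at `(F, N)` iff some Stage-13 record pair `(D, w)` exists (the body of the route's K0′
`Record12Inhabited` at `N`). [cite: Balaban1989LargeFieldII, Thm 1 + (0.1) pp.355–356 (bookkeeping)] -/
theorem exists_isDatumOfRecord₁₃CSep_iff_exists_record :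
    (∃ D : FiniteEpsData F (SU N), IsDatumOfRecord₁₃CSep F N D) ↔ ∃ (D : FiniteEpsData F (SU N)) (w : WorldP), IsRecordOfRecord₁₃CSep F N D w := by
  constructor
  · rintro ⟨_, θ, hP, hθ, rfl⟩
    obtain ⟨w, hw, -⟩ := exists_world_isRecordOfRecord₁₃CSep F N θ hP hθ ⟨hθ.toStage9.gamma_pos, le_rfl⟩
    exact ⟨_, w, hw⟩
  · rintro ⟨D, w, hw⟩
    exact ⟨D, exists_provisos_of_isRecordOfRecord₁₃CSep hw⟩

/-- **THE HONEST REDUCTION OF K0′**: some datum of record exists at `(F, N)` iff SOME Stage-13 parameter tuple is admissible and satisfies every displayed proviso —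
«exhibit ONE admissible `Stage13Params` with EVERY proviso field a theorem» (the K0′ components); inhabitation is NOT claimed in this module.
[cite: Balaban1988Convergent, (2.7) p.255, (2.21) p.258, (2.28) p.259, (3.16) p.268, (3.21) p.269; Balaban1987RG1, (1.12)–(1.15) p.262 (hypothesis dictionary; bookkeeping)] -/
theorem exists_isDatumOfRecord₁₃CSep_iff_exists_params :
    (∃ D : FiniteEpsData F (SU N), IsDatumOfRecord₁₃CSep F N D) ↔ ∃ θ : Stage13Params F N, θ.Provisos₁₃Sep F N ∧ θ.Admissible F N := by
  constructor
  · rintro ⟨_, θ, hP, hθ, -⟩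
    exact ⟨θ, hP, hθ⟩
  · rintro ⟨θ, hP, hθ⟩
    exact ⟨_, isDatumOfRecord₁₃CSep_datumOfRecord₁₃Sep F N θ hP hθ⟩

variable {F N}
variable {D : FiniteEpsData F (SU N)} {w : WorldP}

/-- A Stage-13 record's datum is a Stage-13 datum of record. [cite: Balaban1989LargeFieldII, Thm 1 p.355 (bookkeeping)] -/
theorem isDatumOfRecord₁₃CSep_of_isRecordOfRecord₁₃CSep (h : IsRecordOfRecord₁₃CSep F N D w) : IsDatumOfRecord₁₃CSep F N D :=
  exists_provisos_of_isRecordOfRecord₁₃CSep h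

/-- **DATUM OF RECORD ⟺ RECORD AT SOME WORLD.** [cite: Balaban1989LargeFieldII, Thm 1 + (0.1) pp.355–356 (bookkeeping)] -/
theorem isDatumOfRecord₁₃CSep_iff_exists_world : IsDatumOfRecord₁₃CSep F N D ↔ ∃ w : WorldP, IsRecordOfRecord₁₃CSep F N D w := by
  constructor
  · rintro ⟨θ, hP, hθ, rfl⟩
    obtain ⟨w, hw, -⟩ := exists_world_isRecordOfRecord₁₃CSep F N θ hP hθ ⟨hθ.toStage9.gamma_pos, le_rfl⟩
    exact ⟨w, hw⟩
  · rintro ⟨w, hw⟩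
    exact isDatumOfRecord₁₃CSep_of_isRecordOfRecord₁₃CSep hw

/-- **THE CANONICAL STAGE-13 PARAMETER OF A DATUM OF RECORD** (choice) — the ONE key both carrier records of clusters K4 ∕ K5 are read at.
[cite: Balaban1989LargeFieldII, Thm 1 + (0.1) pp.355–356 (bookkeeping)] -/
def IsDatumOfRecord₁₃CSep.params (h : IsDatumOfRecord₁₃CSep F N D) : Stage13Params F N :=
  Classical.choose h

/-- Its provisos. [cite: Balaban1988Convergent, (2.7) p.255, (2.21) p.258, (2.35) p.261 (bookkeeping)] -/
theorem IsDatumOfRecord₁₃CSep.provisos (h : IsDatumOfRecord₁₃CSep F N D) : h.params.Provisos₁₃Sep F N :=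
  (Classical.choose_spec h).fst

/-- Its admissibility. [cite: Balaban1987RG1, (1.12) p.262; Balaban1988Convergent, (2.10) p.256 (bookkeeping)] -/
theorem IsDatumOfRecord₁₃CSep.admissible (h : IsDatumOfRecord₁₃CSep F N D) : h.params.Admissible F N :=
  (Classical.choose_spec h).snd.1

/-- **The datum IS the datum of record of its canonical parameter.** [cite: Balaban1989LargeFieldII, Thm 1 p.355 (bookkeeping)] -/
theorem IsDatumOfRecord₁₃CSep.eq_datumOfRecord₁₃Sep (h : IsDatumOfRecord₁₃CSep F N D) : D = datumOfRecord₁₃Sep F N h.params h.provisos :=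
  (Classical.choose_spec h).snd.2

/-- The canonical parameter's coupling window is positive. [cite: Balaban1987RG1, (0.21) p.256 (bookkeeping)] -/
theorem IsDatumOfRecord₁₃CSep.gamma_pos (h : IsDatumOfRecord₁₃CSep F N D) : 0 < h.params.γ :=
  h.admissible.toStage9.gamma_pos

/-- … and lies inside `]0, 1[` (the Stage-12 sign `γ < 1` of the tuple's Stage-12 admissibility). [cite: Balaban1988Convergent, (2.28) p.259 (bookkeeping)] -/
theorem IsDatumOfRecord₁₃CSep.gamma_lt_one (h : IsDatumOfRecord₁₃CSep F N D) : h.params.γ < 1 :=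
  h.admissible.toStage12.pos₁₂.2.2.2.2

/-- **WHAT A CONSUMER PROVES ⟹ WHAT THE INSTANCE CARRIES**: a property of the objects of record established at EVERY admissible Stage-13 parameter tuple with provisos
holds at the canonical parameter of every datum of record. [cite: Balaban1989LargeFieldII, Thm 1 p.355 (bookkeeping)] -/
theorem IsDatumOfRecord₁₃CSep.forall_params {P : (D : FiniteEpsData F (SU N)) → (θ : Stage13Params F N) → θ.Provisos₁₃Sep F N → Prop}
    (hP : ∀ (θ : Stage13Params F N) (hθ : θ.Provisos₁₃Sep F N), θ.Admissible F N → P (datumOfRecord₁₃Sep F N θ hθ) θ hθ) (h : IsDatumOfRecord₁₃CSep F N D) :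
    P D h.params h.provisos := by
  have := hP h.params h.provisos h.admissible
  rwa [← h.eq_datumOfRecord₁₃Sep] at this

/-- **WORLD COMPANION IN `₁₃C` AT ANY WINDOW BELOW THE CANONICAL ONE**: for `0 < γw ≤ h.params.γ` some world makes `(D, w)` a Stage-13 record with `w.γ = γw` — what
the N17 home-keying binder («`RRec … R → ∃ w, IsRecordOfRecord₁₃CSep F N D w ∧ R.u3.γ = w.γ`») consumes once `R.u3.γ` is pinned in that range.
[cite: Balaban1989LargeFieldII, Thm 1 + (0.1) pp.355–356 (bookkeeping)] -/
theorem IsDatumOfRecord₁₃CSep.exists_world (h : IsDatumOfRecord₁₃CSep F N D) {γw : ℝ} (hγw : 0 < γw ∧ γw ≤ h.params.γ) :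
    ∃ w : WorldP, IsRecordOfRecord₁₃CSep F N D w ∧ w.γ = γw := by
  obtain ⟨w, hw, hγ⟩ := exists_world_isRecordOfRecord₁₃CSep F N h.params h.provisos h.admissible hγw
  exact ⟨w, h.eq_datumOfRecord₁₃Sep ▸ hw, hγ⟩

/-- … in particular at the canonical window `h.params.γ` itself. [cite: Balaban1989LargeFieldII, Thm 1 + (0.1) pp.355–356 (bookkeeping)] -/
theorem IsDatumOfRecord₁₃CSep.exists_world_gamma (h : IsDatumOfRecord₁₃CSep F N D) :
    ∃ w : WorldP, IsRecordOfRecord₁₃CSep F N D w ∧ w.γ = h.params.γ :=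
  h.exists_world ⟨h.gamma_pos, le_rfl⟩

/-- **THE DATUM's β-FUNCTIONS ARE THE STAGE-13 β OF RECORD AT THE CANONICAL PARAMETER** (def-T's `βfun_datumOfRecord₁₃Sep`, `rfl` there; `betaOfRecord₁₃ F N θ` over
`Stage13Params` is def-T's reducible name for the β of record re-based on the canonical-version transport and the (2.9)-species small-field function — NOT `betaOfRecord₁₀` of Stages 10–12: the histories of record differ, and there is
NO ₁₂ ↔ ₁₃ key bridge in this module) — what the (D4) read-out binders and node N17 read off `D`.
[cite: Balaban1987RG1, (1.20)–(1.22) p.264 (bookkeeping)] -/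
theorem IsDatumOfRecord₁₃CSep.βfun_eq_betaOfRecord₁₃ (h : IsDatumOfRecord₁₃CSep F N D) : D.βfun = betaOfRecord₁₃ F N h.params := by
  have := βfun_datumOfRecord₁₃Sep F N h.params h.provisos
  rwa [← h.eq_datumOfRecord₁₃Sep] at this

/-- The datum's coupling flow of the run `p` IS the Stage-13 generated history of record of the canonical parameter (def-T's `flow_g_datumOfRecord₁₃Sep`).
[cite: Balaban1987RG1, (0.17)–(0.20) pp.255–256 (bookkeeping)] -/
theorem IsDatumOfRecord₁₃CSep.flow_g (h : IsDatumOfRecord₁₃CSep F N D) (p : B12.RunParams) :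
    (D.C p).flow.g = gOfRecord₁₃ F N h.params p := by
  have := flow_g_datumOfRecord₁₃Sep F N h.params h.provisos p
  rwa [← h.eq_datumOfRecord₁₃Sep] at this

/-- The datum's averaging maps ARE the averaging maps of record. [cite: Balaban1987RG1, (0.4) p.253 (bookkeeping)] -/
theorem IsDatumOfRecord₁₃CSep.av_eq (h : IsDatumOfRecord₁₃CSep F N D) : D.av = avOfRecord F N := by
  have := av_datumOfRecord₁₃Sep F N h.params h.provisos
  rwa [← h.eq_datumOfRecord₁₃Sep] at this

/-- A Stage-13 datum of record is a datum of record, Stage 0 (binder B1 ∕ node N23's reading). [cite: Balaban1987RG1, (0.3)–(0.4) p.253 (bookkeeping)] -/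
theorem IsDatumOfRecord₁₃CSep.isDatumOfRecord₀ (h : IsDatumOfRecord₁₃CSep F N D) : IsDatumOfRecord₀ F N D := by
  rw [h.eq_datumOfRecord₁₃Sep]
  exact isDatumOfRecord₀_datumOfRecord₁₃Sep F N h.params h.provisos

/-- N23 · binder B1 at every Stage-13 datum of record. [cite: Balaban1987RG1, (0.4) p.253] -/
theorem IsDatumOfRecord₁₃CSep.isPrintedAveraged (h : IsDatumOfRecord₁₃CSep F N D) : D.IsPrintedAveraged := by
  rw [h.eq_datumOfRecord₁₃Sep]
  exact isPrintedAveraged_datumOfRecord₁₃Sep F N h.params h.provisos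

/-- **THE ₅C SHADOW AT THE CANONICAL PARAMETER**: a Stage-13 datum of record is refined by a Stage-5 C-bound record at some world (def-T's
`exists_isRecordOfRecord₅C_of_isRecordOfRecord₁₃CSep` through the world companion) — for consumers keyed at ₅C. [cite: Balaban1989LargeFieldII, Thm 1 + (0.1) pp.355–356 (bookkeeping)] -/
theorem IsDatumOfRecord₁₃CSep.exists_isRecordOfRecord₅C (h : IsDatumOfRecord₁₃CSep F N D) :
    ∃ (D₅ : FiniteEpsData F (SU N)) (w : WorldP), IsRecordOfRecord₅C F N D₅ w ∧ D₅.C = D.C ∧ (∀ K g₀ k, D₅.dens K g₀ k = D.dens K g₀ k) ∧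
      D₅.βfun = D.βfun ∧ D₅.av = D.av := by
  obtain ⟨w, hw, -⟩ := h.exists_world_gamma
  obtain ⟨D₅, h₅⟩ := exists_isRecordOfRecord₅C_of_isRecordOfRecord₁₃CSep hw
  exact ⟨D₅, w, h₅⟩

end DatumKey

/-! ## §2. Canonicalised readings — COHERENCE for records keyed «`∃ θ hP, θ.Admissible F N ∧ D = datumOfRecord₁₃Sep F N θ hP ∧ S = cr F θ hP …`»

Reading an existentially keyed record through `canon₁₃Sep f` makes the admitted bundle a function of the DATUM: `canon₁₃Sep f θ hP = f h.params h.provisos` whenever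
`datumOfRecord₁₃Sep F N θ hP = D` and `h : IsDatumOfRecord₁₃CSep F N D` (`canon₁₃Sep_eq_of_eq`), so two records keyed independently but read through `canon₁₃Sep` admit, at the
same `(F, D, g₀, os)`, bundles read at the SAME parameter (`exists_keyed_canon₁₃Sep_iff` turns either key into «`∃ h : IsDatumOfRecord₁₃CSep F N D, Φ (f h.params
h.provisos)`»).  Off the datum-of-record class `canon₁₃Sep f = f`. -/
section Canon

variable (F : T4Family) (N : ℕ) [NeZero N] {α : Sort*}

/-- **CANONICALISED READING**: read `f` at the canonical parameter of the datum `datumOfRecord₁₃Sep F N θ hP` when that datum is of record (admissible), else at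
`(θ, hP)` itself.  Kernel bookkeeping (`Classical.dec`, `dite`). [cite: Balaban1989LargeFieldII, Thm 1 + (0.1) pp.355–356 (bookkeeping)] -/
def canon₁₃Sep (f : (θ : Stage13Params F N) → θ.Provisos₁₃Sep F N → α) (θ : Stage13Params F N) (hP : θ.Provisos₁₃Sep F N) : α := by
  classical
  exact if h : IsDatumOfRecord₁₃CSep F N (datumOfRecord₁₃Sep F N θ hP) then f h.params h.provisos else f θ hP

variable {F N}

/-- The canonical parameter depends on the datum only: transport of the key along `D = D'` does not change `.params` (proof irrelevance + `subst`).
[cite: Balaban1989LargeFieldII, Thm 1 + (0.1) pp.355–356 (bookkeeping)] -/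
theorem IsDatumOfRecord₁₃CSep.params_congr {D D' : FiniteEpsData F (SU N)} (h : IsDatumOfRecord₁₃CSep F N D) (h' : IsDatumOfRecord₁₃CSep F N D') (e : D = D') :
    h.params = h'.params := by
  subst e
  rfl

/-- **`canon₁₃Sep f θ hP = f h.params h.provisos`** whenever `(θ, hP)` realises a datum of record `D` with key `h`. [cite: Balaban1989LargeFieldII, Thm 1 + (0.1) pp.355–356 (bookkeeping)] -/
theorem canon₁₃Sep_eq_of_eq {f : (θ : Stage13Params F N) → θ.Provisos₁₃Sep F N → α} {D : FiniteEpsData F (SU N)} (h : IsDatumOfRecord₁₃CSep F N D)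
    (θ : Stage13Params F N) (hP : θ.Provisos₁₃Sep F N) (e : D = datumOfRecord₁₃Sep F N θ hP) :
    canon₁₃Sep F N f θ hP = f h.params h.provisos := by
  subst e
  unfold canon₁₃Sep
  rw [dif_pos h]

/-- At the canonical parameter itself `canon₁₃Sep f` reads `f`. [cite: Balaban1989LargeFieldII, Thm 1 + (0.1) pp.355–356 (bookkeeping)] -/
theorem canon₁₃Sep_params {f : (θ : Stage13Params F N) → θ.Provisos₁₃Sep F N → α} {D : FiniteEpsData F (SU N)} (h : IsDatumOfRecord₁₃CSep F N D) :
    canon₁₃Sep F N f h.params h.provisos = f h.params h.provisos :=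
  canon₁₃Sep_eq_of_eq h h.params h.provisos h.eq_datumOfRecord₁₃Sep

/-- At an admissible tuple with provisos, `canon₁₃Sep f` reads `f` at the canonical parameter of ITS datum. [cite: Balaban1989LargeFieldII, Thm 1 + (0.1) pp.355–356 (bookkeeping)] -/
theorem canon₁₃Sep_eq_of_admissible {f : (θ : Stage13Params F N) → θ.Provisos₁₃Sep F N → α} (θ : Stage13Params F N) (hP : θ.Provisos₁₃Sep F N) (hθ : θ.Admissible F N) :
    canon₁₃Sep F N f θ hP = f (isDatumOfRecord₁₃CSep_datumOfRecord₁₃Sep F N θ hP hθ).params (isDatumOfRecord₁₃CSep_datumOfRecord₁₃Sep F N θ hP hθ).provisos :=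
  canon₁₃Sep_eq_of_eq _ θ hP rfl

/-- Off the datum-of-record class nothing is canonicalised. [cite: Balaban1989LargeFieldII, Thm 1 + (0.1) pp.355–356 (bookkeeping)] -/
theorem canon₁₃Sep_eq_self_of_not {f : (θ : Stage13Params F N) → θ.Provisos₁₃Sep F N → α} (θ : Stage13Params F N) (hP : θ.Provisos₁₃Sep F N)
    (hn : ¬ IsDatumOfRecord₁₃CSep F N (datumOfRecord₁₃Sep F N θ hP)) : canon₁₃Sep F N f θ hP = f θ hP := by
  unfold canon₁₃Sep
  rw [dif_neg hn]

/-- **THE KEYED-RECORD FACE**: an existentially keyed record («some admissible `θ` with provisos realises `D` and the bundle reads `canon₁₃Sep f` there») IS the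
datum-keyed record («the bundle reads `f` at the canonical parameter of `D`») — for every property `Φ` of the reading (e.g. `Φ x := S = x g₀ os`).  This is the
sentence that makes (T-SPINE)'s and (T-RATE)'s Stage-13 records COHERENT. [cite: Balaban1989LargeFieldII, Thm 1 + (0.1) pp.355–356 (bookkeeping)] -/
theorem exists_keyed_canon₁₃Sep_iff {f : (θ : Stage13Params F N) → θ.Provisos₁₃Sep F N → α} {D : FiniteEpsData F (SU N)} (Φ : α → Prop) :
    (∃ (θ : Stage13Params F N) (hP : θ.Provisos₁₃Sep F N), θ.Admissible F N ∧ D = datumOfRecord₁₃Sep F N θ hP ∧ Φ (canon₁₃Sep F N f θ hP)) ↔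
      ∃ h : IsDatumOfRecord₁₃CSep F N D, Φ (f h.params h.provisos) := by
  constructor
  · rintro ⟨θ, hP, hθ, e, hΦ⟩
    have h : IsDatumOfRecord₁₃CSep F N D := ⟨θ, hP, hθ, e⟩
    refine ⟨h, ?_⟩
    rwa [canon₁₃Sep_eq_of_eq (f := f) h θ hP e] at hΦ
  · rintro ⟨h, hΦ⟩
    refine ⟨h.params, h.provisos, h.admissible, h.eq_datumOfRecord₁₃Sep, ?_⟩
    rwa [canon₁₃Sep_params (f := f) h]

/-- **COHERENCE**: two existentially keyed records read through `canon₁₃Sep` admit, at the same datum, readings AT THE SAME PARAMETER.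
[cite: Balaban1989LargeFieldII, Thm 1 + (0.1) pp.355–356 (bookkeeping)] -/
theorem keyed_canon₁₃Sep_coherent {β : Sort*} {f : (θ : Stage13Params F N) → θ.Provisos₁₃Sep F N → α} {g : (θ : Stage13Params F N) → θ.Provisos₁₃Sep F N → β}
    {D : FiniteEpsData F (SU N)} (Φ : α → Prop) (Ψ : β → Prop)
    (hΦ : ∃ (θ : Stage13Params F N) (hP : θ.Provisos₁₃Sep F N), θ.Admissible F N ∧ D = datumOfRecord₁₃Sep F N θ hP ∧ Φ (canon₁₃Sep F N f θ hP))
    (hΨ : ∃ (θ : Stage13Params F N) (hP : θ.Provisos₁₃Sep F N), θ.Admissible F N ∧ D = datumOfRecord₁₃Sep F N θ hP ∧ Ψ (canon₁₃Sep F N g θ hP)) :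
    ∃ h : IsDatumOfRecord₁₃CSep F N D, Φ (f h.params h.provisos) ∧ Ψ (g h.params h.provisos) := by
  obtain ⟨h, h₁⟩ := (exists_keyed_canon₁₃Sep_iff Φ).1 hΦ
  obtain ⟨h', h₂⟩ := (exists_keyed_canon₁₃Sep_iff Ψ).1 hΨ
  exact ⟨h, h₁, h₂⟩

end Canon

/-! ## §3. The θ-exposed Stage-13 record key `IsRateKey₁₃Sep` and the residual ASSIGNMENTS of the rate-record home at Stage 13 (`RateAssignment₁₃` ∕ `SpineAssignment₁₃` over
`Stage13Params`, with the one-token lifts `.ofStage12` ∕ `.ofStage9` of the Stage-12 ∕ Stage-9-typed assignments; RR-1's object containers BY NAME) -/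

section Key

variable (F : T4Family) (N : ℕ) [NeZero N]

/-- **«(D, w) is the Stage-13 record WITH PARAMETERS θ»**: the body of `IsRecordOfRecord₁₃CSep F N D w` with the Stage-13 parameter tuple EXPOSED — θ is admissible and
satisfies its displayed provisos, its datum of record IS `D`, and the world `w` is bound to the construction with a window `0 < w.γ ≤ θ.γ`, Bałaban's block size and
the C-binding of record over the Stage-13 view. [cite: Balaban1989LargeFieldII, Thm 1 + (0.1) pp.355–356; Balaban1987RG1, (0.24)–(0.25) p.257 (objects of record; bookkeeping)] -/
def IsRateKey₁₃Sep (D : FiniteEpsData F (SU N)) (w : WorldP) (θ : Stage13Params F N) : Prop :=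
  ∃ h : θ.Provisos₁₃Sep F N, θ.Admissible F N ∧ D = datumOfRecord₁₃Sep F N θ h ∧ w.C = D.C ∧ (0 < w.γ ∧ w.γ ≤ θ.γ) ∧
    w.L = (θ.L : ℝ) ∧ ∀ P : B12.RunParams, w.up P = upOfRecord₅C F N (θ.toStage5₁₃ F N) P

/-- **A Stage-13 record IS a keyed record for SOME θ, and conversely** (`Iff.rfl`: the key is `IsRecordOfRecord₁₃CSep`'s body). [cite: Balaban1989LargeFieldII, Thm 1 + (0.1) pp.355–356 (bookkeeping)] -/
theorem isRecordOfRecord₁₃CSep_iff_exists_isRateKey₁₃Sep (D : FiniteEpsData F (SU N)) (w : WorldP) :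
    IsRecordOfRecord₁₃CSep F N D w ↔ ∃ θ : Stage13Params F N, IsRateKey₁₃Sep F N D w θ := Iff.rfl

/-- **Pointed form of the key** at the datum of record. [cite: Balaban1989LargeFieldII, Thm 1 + (0.1) pp.355–356 (bookkeeping)] -/
theorem isRateKey₁₃Sep_of_eq (θ : Stage13Params F N) (h : θ.Provisos₁₃Sep F N) (hθ : θ.Admissible F N) (w : WorldP)
    (hC : w.C = (datumOfRecord₁₃Sep F N θ h).C) (hγ : 0 < w.γ ∧ w.γ ≤ θ.γ) (hL : w.L = (θ.L : ℝ))
    (hup : ∀ P, w.up P = upOfRecord₅C F N (θ.toStage5₁₃ F N) P) :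
    IsRateKey₁₃Sep F N (datumOfRecord₁₃Sep F N θ h) w θ :=
  ⟨h, hθ, rfl, hC, hγ, hL, hup⟩

/-- **Every admissible θ satisfying its provisos is keyed at some world with any window `0 < γw ≤ θ.γ`** — inhabitation of the keyed class is Stage 13's exactly.
[cite: Balaban1989LargeFieldII, Thm 1 + (0.1) pp.355–356 (bookkeeping)] -/
theorem exists_world_isRateKey₁₃Sep (θ : Stage13Params F N) (h : θ.Provisos₁₃Sep F N) (hθ : θ.Admissible F N) {γw : ℝ} (hγw : 0 < γw ∧ γw ≤ θ.γ) :
    ∃ w : WorldP, IsRateKey₁₃Sep F N (datumOfRecord₁₃Sep F N θ h) w θ ∧ w.γ = γw := by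
  obtain ⟨w₀⟩ := nonempty_worldP
  exact ⟨{ w₀ with
      C := (datumOfRecord₁₃Sep F N θ h).C, γ := γw, L := (θ.L : ℝ), one_lt_L := by exact_mod_cast θ.hL.2,
      up := fun P => upOfRecord₅C F N (θ.toStage5₁₃ F N) P },
    ⟨h, hθ, rfl, rfl, hγw, rfl, fun _ => rfl⟩, rfl⟩

variable {F N}
variable {D : FiniteEpsData F (SU N)} {w : WorldP} {θ : Stage13Params F N}

/-- A keyed record is a Stage-13 record. [cite: Balaban1989LargeFieldII, Thm 1 + (0.1) pp.355–356 (bookkeeping)] -/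
theorem IsRateKey₁₃Sep.isRecordOfRecord₁₃CSep (hk : IsRateKey₁₃Sep F N D w θ) : IsRecordOfRecord₁₃CSep F N D w := ⟨θ, hk⟩

/-- … hence its datum is a Stage-13 datum of record. [cite: Balaban1989LargeFieldII, Thm 1 p.355 (bookkeeping)] -/
theorem IsRateKey₁₃Sep.isDatumOfRecord₁₃CSep (hk : IsRateKey₁₃Sep F N D w θ) : IsDatumOfRecord₁₃CSep F N D :=
  isDatumOfRecord₁₃CSep_of_isRecordOfRecord₁₃CSep hk.isRecordOfRecord₁₃CSep

/-- The key CERTIFIES θ's provisos and admissibility and realises `D` as θ's datum of record. [cite: Balaban1989LargeFieldI, (0.3)–(0.4) p.176 (bookkeeping)] -/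
theorem IsRateKey₁₃Sep.exists_provisos (hk : IsRateKey₁₃Sep F N D w θ) : ∃ h : θ.Provisos₁₃Sep F N, θ.Admissible F N ∧ D = datumOfRecord₁₃Sep F N θ h := by
  obtain ⟨h, hθ, hD, -⟩ := hk
  exact ⟨h, hθ, hD⟩

/-- The key's θ is admissible. [cite: Balaban1987RG1, (1.20)–(1.21) p.264 (hypothesis dictionary; bookkeeping)] -/
theorem IsRateKey₁₃Sep.admissible (hk : IsRateKey₁₃Sep F N D w θ) : θ.Admissible F N := by
  obtain ⟨-, hθ, -⟩ := hk
  exact hθ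

/-- The world's window is positive. [cite: Balaban1987RG1, Thm 1 p.259 (bookkeeping)] -/
theorem IsRateKey₁₃Sep.gamma_pos (hk : IsRateKey₁₃Sep F N D w θ) : 0 < w.γ := by
  obtain ⟨-, -, -, -, hγ, -⟩ := hk
  exact hγ.1

/-- The world's window sits inside θ's coupling window: `w.γ ≤ θ.γ`. [cite: Balaban1987RG1, Thm 1 p.259 (bookkeeping)] -/
theorem IsRateKey₁₃Sep.gamma_le (hk : IsRateKey₁₃Sep F N D w θ) : w.γ ≤ θ.γ := by
  obtain ⟨-, -, -, -, hγ, -⟩ := hk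
  exact hγ.2

/-- The world reads θ's block factor. [cite: Balaban1987RG1, (0.1) p.251 (bookkeeping)] -/
theorem IsRateKey₁₃Sep.L_eq (hk : IsRateKey₁₃Sep F N D w θ) : w.L = (θ.L : ℝ) := by
  obtain ⟨-, -, -, -, -, hL, -⟩ := hk
  exact hL

/-- The world is bound to the datum's construction. [cite: Balaban1989LargeFieldII, Thm 1 + (0.1) pp.355–356 (bookkeeping)] -/
theorem IsRateKey₁₃Sep.construction_eq (hk : IsRateKey₁₃Sep F N D w θ) : w.C = D.C := by
  obtain ⟨-, -, -, hC, -⟩ := hk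
  exact hC

/-- The upstream block of the world is the C-binding of record at the Stage-13 view. [cite: Balaban1989LargeFieldII, Thm 1 + (0.1) pp.355–356 (bookkeeping)] -/
theorem IsRateKey₁₃Sep.up_eq (hk : IsRateKey₁₃Sep F N D w θ) (P : B12.RunParams) : w.up P = upOfRecord₅C F N (θ.toStage5₁₃ F N) P := by
  obtain ⟨-, -, -, -, -, -, hup⟩ := hk
  exact hup P

end Key

/-! ## §4. «`D` is a datum of record, Stage 13, realised IN THE REGIME `Rg`» and its canonical parameter in the regime -/

section DatumKeyOn

variable (F : T4Family) (N : ℕ) [NeZero N]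

/-- **«`D` is a datum of record, Stage 13, realised in the regime `Rg`»**: SOME admissible Stage-13 parameter tuple IN `Rg` satisfying its displayed provisos has `D` as its datum
of record — the common key prefix of the regime-restricted carrier homes (the Stage-13 re-keys of `YMDAG.UVSplit.RRec₁₂On 𝔯 Rg` ∕ `SRec₁₂On cr Rg`).  At `Rg := ⊤` it is the C key (`isDatumOfRecord₁₃CSepOn_true_iff`).
[cite: Balaban1989LargeFieldII, Thm 1 + (0.1) pp.355–356; Balaban1988Convergent, Thms 1–2 pp.262–263 (objects of record; bookkeeping)] -/
def IsDatumOfRecord₁₃CSepOn (Rg : (F : T4Family) → Stage13Params F N → Prop) (D : FiniteEpsData F (SU N)) : Prop :=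
  ∃ (θ : Stage13Params F N) (h : θ.Provisos₁₃Sep F N), Rg F θ ∧ θ.Admissible F N ∧ D = datumOfRecord₁₃Sep F N θ h

variable (Rg : (F : T4Family) → Stage13Params F N → Prop)

/-- Unfolding (`Iff.rfl`). [cite: Balaban1989LargeFieldII, Thm 1 + (0.1) pp.355–356 (bookkeeping)] -/
theorem isDatumOfRecord₁₃CSepOn_iff (D : FiniteEpsData F (SU N)) :
    IsDatumOfRecord₁₃CSepOn F N Rg D ↔ ∃ (θ : Stage13Params F N) (h : θ.Provisos₁₃Sep F N), Rg F θ ∧ θ.Admissible F N ∧ D = datumOfRecord₁₃Sep F N θ h :=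
  Iff.rfl

/-- Every admissible Stage-13 parameter tuple in the regime with provisos yields a datum of record in the regime. [cite: Balaban1989LargeFieldII, Thm 1 + (0.1) pp.355–356 (bookkeeping)] -/
theorem isDatumOfRecord₁₃CSepOn_datumOfRecord₁₃Sep (θ : Stage13Params F N) (h : θ.Provisos₁₃Sep F N) (hRg : Rg F θ) (hθ : θ.Admissible F N) :
    IsDatumOfRecord₁₃CSepOn F N Rg (datumOfRecord₁₃Sep F N θ h) :=
  ⟨θ, h, hRg, hθ, rfl⟩

/-- **THE HONEST REDUCTION, IN THE REGIME**: some datum of record in `Rg` exists at `(F, N)` iff SOME Stage-13 parameter tuple satisfies every displayed proviso, lies in `Rg` and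
is admissible; inhabitation is NOT claimed in this module. [cite: Balaban1988Convergent, (2.7) p.255, (2.21) p.258, (3.16)–(3.22) pp.268–269; Balaban1987RG1, (1.12)–(1.15) p.262 (hypothesis dictionary; bookkeeping)] -/
theorem exists_isDatumOfRecord₁₃CSepOn_iff_exists_params :
    (∃ D : FiniteEpsData F (SU N), IsDatumOfRecord₁₃CSepOn F N Rg D) ↔ ∃ θ : Stage13Params F N, θ.Provisos₁₃Sep F N ∧ Rg F θ ∧ θ.Admissible F N := by
  constructor
  · rintro ⟨_, θ, hP, hRg, hθ, -⟩
    exact ⟨θ, hP, hRg, hθ⟩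
  · rintro ⟨θ, hP, hRg, hθ⟩
    exact ⟨_, isDatumOfRecord₁₃CSepOn_datumOfRecord₁₃Sep F N Rg θ hP hRg hθ⟩

/-- **A PROPERTY OF EVERY DATUM OF RECORD IN THE REGIME ⟺ THE θ-KEYED SENTENCE GUARDED BY `Rg`** (datum level). [cite: Balaban1989LargeFieldII, Thm 1 + (0.1) pp.355–356 (bookkeeping)] -/
theorem forall_isDatumOfRecord₁₃CSepOn_iff (P : FiniteEpsData F (SU N) → Prop) :
    (∀ D : FiniteEpsData F (SU N), IsDatumOfRecord₁₃CSepOn F N Rg D → P D) ↔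
      ∀ (θ : Stage13Params F N) (h : θ.Provisos₁₃Sep F N), Rg F θ → θ.Admissible F N → P (datumOfRecord₁₃Sep F N θ h) := by
  constructor
  · intro hall θ h hRg hθ
    exact hall _ (isDatumOfRecord₁₃CSepOn_datumOfRecord₁₃Sep F N Rg θ h hRg hθ)
  · rintro hall D ⟨θ, h, hRg, hθ, rfl⟩
    exact hall θ h hRg hθ

variable {F N Rg}
variable {D : FiniteEpsData F (SU N)}

/-- The regime forgotten: a datum of record in `Rg` is a datum of record (C key). [cite: Balaban1989LargeFieldII, Thm 1 p.355 (bookkeeping)] -/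
theorem IsDatumOfRecord₁₃CSepOn.toC (h : IsDatumOfRecord₁₃CSepOn F N Rg D) : IsDatumOfRecord₁₃CSep F N D := by
  obtain ⟨θ, hP, -, hθ, hD⟩ := h
  exact ⟨θ, hP, hθ, hD⟩

/-- Monotone in the regime. [cite: Balaban1989LargeFieldII, Thm 1 p.355 (bookkeeping)] -/
theorem IsDatumOfRecord₁₃CSepOn.mono {Rg' : (F : T4Family) → Stage13Params F N → Prop} (hle : ∀ (F : T4Family) (θ : Stage13Params F N), Rg F θ → Rg' F θ)
    (h : IsDatumOfRecord₁₃CSepOn F N Rg D) : IsDatumOfRecord₁₃CSepOn F N Rg' D := by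
  obtain ⟨θ, hP, hRg, hθ, hD⟩ := h
  exact ⟨θ, hP, hle F θ hRg, hθ, hD⟩

/-- At the trivial regime the key IS the C key. [cite: Balaban1989LargeFieldII, Thm 1 p.355 (bookkeeping)] -/
theorem isDatumOfRecord₁₃CSepOn_true_iff : IsDatumOfRecord₁₃CSepOn F N (fun _ _ => True) D ↔ IsDatumOfRecord₁₃CSep F N D :=
  ⟨fun h => h.toC, fun ⟨θ, hP, hθ, hD⟩ => ⟨θ, hP, trivial, hθ, hD⟩⟩

/-- A datum of record whose C-CANONICAL parameter lies in the regime is a datum of record in the regime (companion of the (T-RATE) home's `rRec₁₂On_of_regime_params`, re-keyed).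
[cite: Balaban1989LargeFieldII, Thm 1 p.355 (bookkeeping)] -/
theorem IsDatumOfRecord₁₃CSep.isDatumOfRecord₁₃CSepOn_of_regime_params (h : IsDatumOfRecord₁₃CSep F N D) (hRg : Rg F h.params) : IsDatumOfRecord₁₃CSepOn F N Rg D :=
  ⟨h.params, h.provisos, hRg, h.admissible, h.eq_datumOfRecord₁₃Sep⟩

/-- **THE CANONICAL STAGE-13 PARAMETER OF A DATUM OF RECORD IN THE REGIME** (choice).  HONEST: it need not equal the C-canonical parameter `h.toC.params` of the same datum
(two choices over two existentials); the regime reaches THIS parameter (`.regime`), never `IsDatumOfRecord₁₃CSep.params`. [cite: Balaban1989LargeFieldII, Thm 1 + (0.1) pp.355–356 (bookkeeping)] -/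
def IsDatumOfRecord₁₃CSepOn.params (h : IsDatumOfRecord₁₃CSepOn F N Rg D) : Stage13Params F N :=
  Classical.choose h

/-- Its provisos. [cite: Balaban1988Convergent, (2.7) p.255, (2.21) p.258, (2.35) p.261 (bookkeeping)] -/
theorem IsDatumOfRecord₁₃CSepOn.provisos (h : IsDatumOfRecord₁₃CSepOn F N Rg D) : h.params.Provisos₁₃Sep F N :=
  (Classical.choose_spec h).fst

/-- **It lies IN THE REGIME.** [cite: Balaban1988Convergent, (3.16)–(3.22) pp.268–269 (bookkeeping)] -/
theorem IsDatumOfRecord₁₃CSepOn.regime (h : IsDatumOfRecord₁₃CSepOn F N Rg D) : Rg F h.params :=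
  (Classical.choose_spec h).snd.1

/-- Its admissibility. [cite: Balaban1987RG1, (1.12) p.262; Balaban1988Convergent, (2.10) p.256 (bookkeeping)] -/
theorem IsDatumOfRecord₁₃CSepOn.admissible (h : IsDatumOfRecord₁₃CSepOn F N Rg D) : h.params.Admissible F N :=
  (Classical.choose_spec h).snd.2.1

/-- **The datum IS the datum of record of its canonical parameter in the regime.** [cite: Balaban1989LargeFieldII, Thm 1 p.355 (bookkeeping)] -/
theorem IsDatumOfRecord₁₃CSepOn.eq_datumOfRecord₁₃Sep (h : IsDatumOfRecord₁₃CSepOn F N Rg D) : D = datumOfRecord₁₃Sep F N h.params h.provisos :=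
  (Classical.choose_spec h).snd.2.2

/-- The canonical parameter realises a C-datum key of `D` (pointed form; its `.params` is NOT asserted to be `h.params`). [cite: Balaban1989LargeFieldII, Thm 1 p.355 (bookkeeping)] -/
theorem IsDatumOfRecord₁₃CSepOn.isDatumOfRecord₁₃CSep_params (h : IsDatumOfRecord₁₃CSepOn F N Rg D) :
    IsDatumOfRecord₁₃CSep F N (datumOfRecord₁₃Sep F N h.params h.provisos) :=
  isDatumOfRecord₁₃CSep_datumOfRecord₁₃Sep F N h.params h.provisos h.admissible

/-- The canonical parameter's coupling window is positive. [cite: Balaban1987RG1, (0.21) p.256 (bookkeeping)] -/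
theorem IsDatumOfRecord₁₃CSepOn.gamma_pos (h : IsDatumOfRecord₁₃CSepOn F N Rg D) : 0 < h.params.γ :=
  h.admissible.toStage9.gamma_pos

/-- … and lies inside `]0, 1[`. [cite: Balaban1988Convergent, (2.28) p.259 (bookkeeping)] -/
theorem IsDatumOfRecord₁₃CSepOn.gamma_lt_one (h : IsDatumOfRecord₁₃CSepOn F N Rg D) : h.params.γ < 1 :=
  h.admissible.toStage12.pos₁₂.2.2.2.2

/-- The canonical parameter in the regime depends on the datum only. [cite: Balaban1989LargeFieldII, Thm 1 + (0.1) pp.355–356 (bookkeeping)] -/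
theorem IsDatumOfRecord₁₃CSepOn.params_congr {D' : FiniteEpsData F (SU N)} (h : IsDatumOfRecord₁₃CSepOn F N Rg D) (h' : IsDatumOfRecord₁₃CSepOn F N Rg D') (e : D = D') :
    h.params = h'.params := by
  subst e
  rfl

/-- **WHAT A CONSUMER PROVES IN THE REGIME ⟹ WHAT THE INSTANCE CARRIES**: a property of the objects of record established at EVERY admissible Stage-13 parameter tuple IN `Rg` with
provisos holds at the canonical parameter in the regime of every datum of record in the regime — the regime is AVAILABLE as a hypothesis. [cite: Balaban1989LargeFieldII, Thm 1 p.355 (bookkeeping)] -/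
theorem IsDatumOfRecord₁₃CSepOn.forall_params {P : (D : FiniteEpsData F (SU N)) → (θ : Stage13Params F N) → θ.Provisos₁₃Sep F N → Prop}
    (hP : ∀ (θ : Stage13Params F N) (hθ : θ.Provisos₁₃Sep F N), Rg F θ → θ.Admissible F N → P (datumOfRecord₁₃Sep F N θ hθ) θ hθ) (h : IsDatumOfRecord₁₃CSepOn F N Rg D) :
    P D h.params h.provisos := by
  have := hP h.params h.provisos h.regime h.admissible
  rwa [← h.eq_datumOfRecord₁₃Sep] at this

/-- The datum's β-functions are the Stage-13 β of record at the canonical parameter. [cite: Balaban1987RG1, (1.20)–(1.22) p.264 (bookkeeping)] -/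
theorem IsDatumOfRecord₁₃CSepOn.βfun_eq_betaOfRecord₁₃ (h : IsDatumOfRecord₁₃CSepOn F N Rg D) : D.βfun = betaOfRecord₁₃ F N h.params := by
  have := βfun_datumOfRecord₁₃Sep F N h.params h.provisos
  rwa [← h.eq_datumOfRecord₁₃Sep] at this

/-- The datum's coupling flow of the run `p` IS the Stage-13 generated history of record of the canonical parameter. [cite: Balaban1987RG1, (0.17)–(0.20) pp.255–256 (bookkeeping)] -/
theorem IsDatumOfRecord₁₃CSepOn.flow_g (h : IsDatumOfRecord₁₃CSepOn F N Rg D) (p : B12.RunParams) :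
    (D.C p).flow.g = gOfRecord₁₃ F N h.params p := by
  have := flow_g_datumOfRecord₁₃Sep F N h.params h.provisos p
  rwa [← h.eq_datumOfRecord₁₃Sep] at this

/-- A datum of record in the regime is a datum of record, Stage 0. [cite: Balaban1987RG1, (0.3)–(0.4) p.253 (bookkeeping)] -/
theorem IsDatumOfRecord₁₃CSepOn.isDatumOfRecord₀ (h : IsDatumOfRecord₁₃CSepOn F N Rg D) : IsDatumOfRecord₀ F N D :=
  h.toC.isDatumOfRecord₀

end DatumKeyOn

/-! ## §5. «`(D, w)` is a Stage-13 record realised IN THE REGIME `Rg`»; world companions; the θ-keyed guarded junction -/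

section RecordKeyOn

variable (F : T4Family) (N : ℕ) [NeZero N]

/-- **«`(D, w)` is a Stage-13 record (C-class) realised in the regime `Rg`»**: `IsRecordOfRecord₁₃CSep F N D w`'s body (the θ-exposed key `IsRateKey₁₃Sep`) with the parameter IN
`Rg` — the regime-restricted record class a guarded composer quantifies over (`Spine`, `S_R00x`, `S_N27x` at `fun F D w => IsRecordOfRecord₁₃CSepOn F N Rg D w`).  At `Rg := ⊤` it is
`IsRecordOfRecord₁₃CSep` (`isRecordOfRecord₁₃CSepOn_true_iff`). [cite: Balaban1989LargeFieldII, Thm 1 + (0.1) pp.355–356; Balaban1987RG1, (0.24)–(0.25) p.257 (objects of record; bookkeeping)] -/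
def IsRecordOfRecord₁₃CSepOn (Rg : (F : T4Family) → Stage13Params F N → Prop) (D : FiniteEpsData F (SU N)) (w : WorldP) : Prop :=
  ∃ θ : Stage13Params F N, Rg F θ ∧ IsRateKey₁₃Sep F N D w θ

variable (Rg : (F : T4Family) → Stage13Params F N → Prop)

/-- Unfolding (`Iff.rfl`). [cite: Balaban1989LargeFieldII, Thm 1 + (0.1) pp.355–356 (bookkeeping)] -/
theorem isRecordOfRecord₁₃CSepOn_iff (D : FiniteEpsData F (SU N)) (w : WorldP) :
    IsRecordOfRecord₁₃CSepOn F N Rg D w ↔ ∃ θ : Stage13Params F N, Rg F θ ∧ IsRateKey₁₃Sep F N D w θ :=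
  Iff.rfl

/-- **Every admissible θ in the regime with provisos is a record in the regime at some world with any window `0 < γw ≤ θ.γ`.** [cite: Balaban1989LargeFieldII, Thm 1 + (0.1) pp.355–356 (bookkeeping)] -/
theorem exists_world_isRecordOfRecord₁₃CSepOn (θ : Stage13Params F N) (h : θ.Provisos₁₃Sep F N) (hRg : Rg F θ) (hθ : θ.Admissible F N) {γw : ℝ}
    (hγw : 0 < γw ∧ γw ≤ θ.γ) : ∃ w : WorldP, IsRecordOfRecord₁₃CSepOn F N Rg (datumOfRecord₁₃Sep F N θ h) w ∧ w.γ = γw := by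
  obtain ⟨w, hk, hγ⟩ := exists_world_isRateKey₁₃Sep F N θ h hθ hγw
  exact ⟨w, ⟨θ, hRg, hk⟩, hγ⟩

/-- Some datum of record in the regime exists iff some record in the regime exists. [cite: Balaban1989LargeFieldII, Thm 1 + (0.1) pp.355–356 (bookkeeping)] -/
theorem exists_isDatumOfRecord₁₃CSepOn_iff_exists_record :
    (∃ D : FiniteEpsData F (SU N), IsDatumOfRecord₁₃CSepOn F N Rg D) ↔ ∃ (D : FiniteEpsData F (SU N)) (w : WorldP), IsRecordOfRecord₁₃CSepOn F N Rg D w := by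
  constructor
  · rintro ⟨_, θ, hP, hRg, hθ, rfl⟩
    obtain ⟨w, hw, -⟩ := exists_world_isRecordOfRecord₁₃CSepOn F N Rg θ hP hRg hθ ⟨hθ.toStage9.gamma_pos, le_rfl⟩
    exact ⟨_, w, hw⟩
  · rintro ⟨D, w, θ, hRg, hk⟩
    obtain ⟨hP, hθ, hD⟩ := hk.exists_provisos
    exact ⟨D, θ, hP, hRg, hθ, hD⟩

/-- **A WORLD-BLIND PROPERTY AT EVERY RECORD IN THE REGIME ⟺ THE θ-KEYED SENTENCE GUARDED BY `Rg`** — the junction between a composer's conclusion over the regime-restricted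
record class (e.g. `YMDAG.UVSplit.Spine` at `IsRecordOfRecord₁₃CSepOn F N Rg`) and an item text «`∀ θ (h : θ.Provisos₁₃Sep F N), Rg F θ → θ.Admissible F N → P (datumOfRecord₁₃Sep F N θ h)`».
[cite: Balaban1989LargeFieldII, Thm 1 + (0.1) pp.355–356 (bookkeeping)] -/
theorem forall_isRecordOfRecord₁₃CSepOn_iff (P : FiniteEpsData F (SU N) → Prop) :
    (∀ (D : FiniteEpsData F (SU N)) (w : WorldP), IsRecordOfRecord₁₃CSepOn F N Rg D w → P D) ↔
      ∀ (θ : Stage13Params F N) (h : θ.Provisos₁₃Sep F N), Rg F θ → θ.Admissible F N → P (datumOfRecord₁₃Sep F N θ h) := by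
  constructor
  · intro hall θ h hRg hθ
    obtain ⟨w, hw, -⟩ := exists_world_isRecordOfRecord₁₃CSepOn F N Rg θ h hRg hθ ⟨hθ.toStage9.gamma_pos, le_rfl⟩
    exact hall _ w hw
  · rintro hall D w ⟨θ, hRg, hk⟩
    obtain ⟨h, hθ, rfl⟩ := hk.exists_provisos
    exact hall θ h hRg hθ

variable {F N Rg}
variable {D : FiniteEpsData F (SU N)} {w : WorldP}

/-- The regime forgotten: a record in the regime is a Stage-13 record. [cite: Balaban1989LargeFieldII, Thm 1 p.355 (bookkeeping)] -/
theorem IsRecordOfRecord₁₃CSepOn.isRecordOfRecord₁₃CSep (h : IsRecordOfRecord₁₃CSepOn F N Rg D w) : IsRecordOfRecord₁₃CSep F N D w := by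
  obtain ⟨θ, -, hk⟩ := h
  exact hk.isRecordOfRecord₁₃CSep

/-- Its datum is a datum of record in the regime. [cite: Balaban1989LargeFieldII, Thm 1 p.355 (bookkeeping)] -/
theorem IsRecordOfRecord₁₃CSepOn.isDatumOfRecord₁₃CSepOn (h : IsRecordOfRecord₁₃CSepOn F N Rg D w) : IsDatumOfRecord₁₃CSepOn F N Rg D := by
  obtain ⟨θ, hRg, hk⟩ := h
  obtain ⟨hP, hθ, hD⟩ := hk.exists_provisos
  exact ⟨θ, hP, hRg, hθ, hD⟩

/-- **THE TUPLE IN THE REGIME BEHIND A RECORD IN THE REGIME** — exactly the hypothesis shape of the (T-RATE) home's `s_R00x_rRec₁₂On_of_regime` (to be re-keyed at ₁₃) («every record of `Rec` comes with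
an admissible tuple with provisos in the regime realising `D`»): ONE application. [cite: Balaban1989LargeFieldII, Thm 1 + (0.1) pp.355–356 (bookkeeping)] -/
theorem IsRecordOfRecord₁₃CSepOn.exists_regime_tuple (h : IsRecordOfRecord₁₃CSepOn F N Rg D w) :
    ∃ (θ : Stage13Params F N) (hP : θ.Provisos₁₃Sep F N), Rg F θ ∧ θ.Admissible F N ∧ D = datumOfRecord₁₃Sep F N θ hP :=
  h.isDatumOfRecord₁₃CSepOn

/-- Monotone in the regime. [cite: Balaban1989LargeFieldII, Thm 1 p.355 (bookkeeping)] -/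
theorem IsRecordOfRecord₁₃CSepOn.mono {Rg' : (F : T4Family) → Stage13Params F N → Prop} (hle : ∀ (F : T4Family) (θ : Stage13Params F N), Rg F θ → Rg' F θ)
    (h : IsRecordOfRecord₁₃CSepOn F N Rg D w) : IsRecordOfRecord₁₃CSepOn F N Rg' D w := by
  obtain ⟨θ, hRg, hk⟩ := h
  exact ⟨θ, hle F θ hRg, hk⟩

/-- The world's window is positive. [cite: Balaban1987RG1, Thm 1 p.259 (bookkeeping)] -/
theorem IsRecordOfRecord₁₃CSepOn.gamma_pos (h : IsRecordOfRecord₁₃CSepOn F N Rg D w) : 0 < w.γ := by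
  obtain ⟨θ, -, hk⟩ := h
  exact hk.gamma_pos

/-- The world is bound to the datum's construction. [cite: Balaban1989LargeFieldII, Thm 1 + (0.1) pp.355–356 (bookkeeping)] -/
theorem IsRecordOfRecord₁₃CSepOn.construction_eq (h : IsRecordOfRecord₁₃CSepOn F N Rg D w) : w.C = D.C := by
  obtain ⟨θ, -, hk⟩ := h
  exact hk.construction_eq

/-- A Stage-13 record keyed at a θ IN THE REGIME is a record in the regime (pointed intro). [cite: Balaban1989LargeFieldII, Thm 1 + (0.1) pp.355–356 (bookkeeping)] -/
theorem IsRateKey₁₃Sep.isRecordOfRecord₁₃CSepOn {θ : Stage13Params F N} (hk : IsRateKey₁₃Sep F N D w θ) (hRg : Rg F θ) : IsRecordOfRecord₁₃CSepOn F N Rg D w :=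
  ⟨θ, hRg, hk⟩

/-- At the trivial regime the record key IS `IsRecordOfRecord₁₃CSep`. [cite: Balaban1989LargeFieldII, Thm 1 p.355 (bookkeeping)] -/
theorem isRecordOfRecord₁₃CSepOn_true_iff : IsRecordOfRecord₁₃CSepOn F N (fun _ _ => True) D w ↔ IsRecordOfRecord₁₃CSep F N D w :=
  ⟨fun h => h.isRecordOfRecord₁₃CSep, fun ⟨θ, hk⟩ => ⟨θ, trivial, hk⟩⟩

/-- **DATUM OF RECORD IN THE REGIME ⟺ RECORD IN THE REGIME AT SOME WORLD.** [cite: Balaban1989LargeFieldII, Thm 1 + (0.1) pp.355–356 (bookkeeping)] -/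
theorem isDatumOfRecord₁₃CSepOn_iff_exists_world : IsDatumOfRecord₁₃CSepOn F N Rg D ↔ ∃ w : WorldP, IsRecordOfRecord₁₃CSepOn F N Rg D w := by
  constructor
  · rintro ⟨θ, hP, hRg, hθ, rfl⟩
    obtain ⟨w, hw, -⟩ := exists_world_isRecordOfRecord₁₃CSepOn F N Rg θ hP hRg hθ ⟨hθ.toStage9.gamma_pos, le_rfl⟩
    exact ⟨w, hw⟩
  · rintro ⟨w, hw⟩
    exact hw.isDatumOfRecord₁₃CSepOn

/-- **WORLD COMPANION IN THE REGIME AT ANY WINDOW BELOW THE CANONICAL ONE** (what an N17-type home-keying binder consumes once the U3 radius is pinned in `]0, h.params.γ]`).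
[cite: Balaban1989LargeFieldII, Thm 1 + (0.1) pp.355–356 (bookkeeping)] -/
theorem IsDatumOfRecord₁₃CSepOn.exists_world (h : IsDatumOfRecord₁₃CSepOn F N Rg D) {γw : ℝ} (hγw : 0 < γw ∧ γw ≤ h.params.γ) :
    ∃ w : WorldP, IsRecordOfRecord₁₃CSepOn F N Rg D w ∧ w.γ = γw := by
  obtain ⟨w, hw, hγ⟩ := exists_world_isRecordOfRecord₁₃CSepOn F N Rg h.params h.provisos h.regime h.admissible hγw
  exact ⟨w, h.eq_datumOfRecord₁₃Sep ▸ hw, hγ⟩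

/-- … in particular at the canonical window itself. [cite: Balaban1989LargeFieldII, Thm 1 + (0.1) pp.355–356 (bookkeeping)] -/
theorem IsDatumOfRecord₁₃CSepOn.exists_world_gamma (h : IsDatumOfRecord₁₃CSepOn F N Rg D) :
    ∃ w : WorldP, IsRecordOfRecord₁₃CSepOn F N Rg D w ∧ w.γ = h.params.γ :=
  h.exists_world ⟨h.gamma_pos, le_rfl⟩

/-- The ₅C shadow at the canonical parameter in the regime (for consumers keyed at ₅C). [cite: Balaban1989LargeFieldII, Thm 1 + (0.1) pp.355–356 (bookkeeping)] -/
theorem IsDatumOfRecord₁₃CSepOn.exists_isRecordOfRecord₅C (h : IsDatumOfRecord₁₃CSepOn F N Rg D) :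
    ∃ (D₅ : FiniteEpsData F (SU N)) (w : WorldP), IsRecordOfRecord₅C F N D₅ w ∧ D₅.C = D.C ∧ (∀ K g₀ k, D₅.dens K g₀ k = D.dens K g₀ k) ∧
      D₅.βfun = D.βfun ∧ D₅.av = D.av :=
  h.toC.exists_isRecordOfRecord₅C

end RecordKeyOn

/-! ## §6. Canonicalised readings RELATIVE TO THE REGIME — coherence for regime homes keyed «`∃ θ hP, Rg F θ ∧ θ.Admissible F N ∧ D = datumOfRecord₁₃Sep F N θ hP ∧ S = cr F θ hP …`»

As `canon₁₃Sep` (gen 2) for the C key: reading a regime-keyed record through `canon₁₃SepOn Rg f` makes the admitted bundle a function of the DATUM, read at the canonical parameter IN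
THE REGIME, so two regime homes read through `canon₁₃SepOn Rg` admit, at the same `(F, D, g₀, os)`, bundles read at ONE parameter (`exists_keyed_canon₁₃SepOn_iff`,
`keyed_canon₁₃SepOn_coherent`).  Off the class `canon₁₃SepOn Rg f = f`. -/
section CanonOn

variable (F : T4Family) (N : ℕ) [NeZero N] (Rg : (F : T4Family) → Stage13Params F N → Prop) {α : Sort*}

/-- **CANONICALISED READING RELATIVE TO THE REGIME**: read `f` at the canonical parameter in `Rg` of the datum `datumOfRecord₁₃Sep F N θ hP` when that datum is of record in the
regime, else at `(θ, hP)` itself.  Kernel bookkeeping (`Classical.dec`, `dite`). [cite: Balaban1989LargeFieldII, Thm 1 + (0.1) pp.355–356 (bookkeeping)] -/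
def canon₁₃SepOn (f : (θ : Stage13Params F N) → θ.Provisos₁₃Sep F N → α) (θ : Stage13Params F N) (hP : θ.Provisos₁₃Sep F N) : α := by
  classical
  exact if h : IsDatumOfRecord₁₃CSepOn F N Rg (datumOfRecord₁₃Sep F N θ hP) then f h.params h.provisos else f θ hP

variable {F N Rg}

/-- **`canon₁₃SepOn Rg f θ hP = f h.params h.provisos`** whenever `(θ, hP)` realises a datum of record in the regime `D` with key `h`. [cite: Balaban1989LargeFieldII, Thm 1 + (0.1) pp.355–356 (bookkeeping)] -/
theorem canon₁₃SepOn_eq_of_eq {f : (θ : Stage13Params F N) → θ.Provisos₁₃Sep F N → α} {D : FiniteEpsData F (SU N)} (h : IsDatumOfRecord₁₃CSepOn F N Rg D)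
    (θ : Stage13Params F N) (hP : θ.Provisos₁₃Sep F N) (e : D = datumOfRecord₁₃Sep F N θ hP) :
    canon₁₃SepOn F N Rg f θ hP = f h.params h.provisos := by
  subst e
  unfold canon₁₃SepOn
  rw [dif_pos h]

/-- At the canonical parameter in the regime `canon₁₃SepOn Rg f` reads `f`. [cite: Balaban1989LargeFieldII, Thm 1 + (0.1) pp.355–356 (bookkeeping)] -/
theorem canon₁₃SepOn_params {f : (θ : Stage13Params F N) → θ.Provisos₁₃Sep F N → α} {D : FiniteEpsData F (SU N)} (h : IsDatumOfRecord₁₃CSepOn F N Rg D) :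
    canon₁₃SepOn F N Rg f h.params h.provisos = f h.params h.provisos :=
  canon₁₃SepOn_eq_of_eq h h.params h.provisos h.eq_datumOfRecord₁₃Sep

/-- At an admissible tuple IN THE REGIME with provisos, `canon₁₃SepOn Rg f` reads `f` at the canonical parameter in the regime of ITS datum. [cite: Balaban1989LargeFieldII, Thm 1 + (0.1) pp.355–356 (bookkeeping)] -/
theorem canon₁₃SepOn_eq_of_regime {f : (θ : Stage13Params F N) → θ.Provisos₁₃Sep F N → α} (θ : Stage13Params F N) (hP : θ.Provisos₁₃Sep F N) (hRg : Rg F θ)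
    (hθ : θ.Admissible F N) :
    canon₁₃SepOn F N Rg f θ hP = f (isDatumOfRecord₁₃CSepOn_datumOfRecord₁₃Sep F N Rg θ hP hRg hθ).params (isDatumOfRecord₁₃CSepOn_datumOfRecord₁₃Sep F N Rg θ hP hRg hθ).provisos :=
  canon₁₃SepOn_eq_of_eq _ θ hP rfl

/-- Off the class nothing is canonicalised. [cite: Balaban1989LargeFieldII, Thm 1 + (0.1) pp.355–356 (bookkeeping)] -/
theorem canon₁₃SepOn_eq_self_of_not {f : (θ : Stage13Params F N) → θ.Provisos₁₃Sep F N → α} (θ : Stage13Params F N) (hP : θ.Provisos₁₃Sep F N)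
    (hn : ¬ IsDatumOfRecord₁₃CSepOn F N Rg (datumOfRecord₁₃Sep F N θ hP)) : canon₁₃SepOn F N Rg f θ hP = f θ hP := by
  unfold canon₁₃SepOn
  rw [dif_neg hn]

/-- **THE KEYED-RECORD FACE, IN THE REGIME**: a regime-keyed record read through `canon₁₃SepOn Rg f` IS the datum-keyed record «the bundle reads `f` at the canonical parameter in
the regime of `D`», for every property `Φ` of the reading. [cite: Balaban1989LargeFieldII, Thm 1 + (0.1) pp.355–356 (bookkeeping)] -/
theorem exists_keyed_canon₁₃SepOn_iff {f : (θ : Stage13Params F N) → θ.Provisos₁₃Sep F N → α} {D : FiniteEpsData F (SU N)} (Φ : α → Prop) :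
    (∃ (θ : Stage13Params F N) (hP : θ.Provisos₁₃Sep F N), Rg F θ ∧ θ.Admissible F N ∧ D = datumOfRecord₁₃Sep F N θ hP ∧ Φ (canon₁₃SepOn F N Rg f θ hP)) ↔
      ∃ h : IsDatumOfRecord₁₃CSepOn F N Rg D, Φ (f h.params h.provisos) := by
  constructor
  · rintro ⟨θ, hP, hRg, hθ, e, hΦ⟩
    have h : IsDatumOfRecord₁₃CSepOn F N Rg D := ⟨θ, hP, hRg, hθ, e⟩
    refine ⟨h, ?_⟩
    rwa [canon₁₃SepOn_eq_of_eq (f := f) h θ hP e] at hΦ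
  · rintro ⟨h, hΦ⟩
    refine ⟨h.params, h.provisos, h.regime, h.admissible, h.eq_datumOfRecord₁₃Sep, ?_⟩
    rwa [canon₁₃SepOn_params (f := f) h]

/-- **COHERENCE IN THE REGIME**: two regime-keyed records read through `canon₁₃SepOn Rg` admit, at the same datum, readings AT THE SAME PARAMETER.
[cite: Balaban1989LargeFieldII, Thm 1 + (0.1) pp.355–356 (bookkeeping)] -/
theorem keyed_canon₁₃SepOn_coherent {β : Sort*} {f : (θ : Stage13Params F N) → θ.Provisos₁₃Sep F N → α} {g : (θ : Stage13Params F N) → θ.Provisos₁₃Sep F N → β}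
    {D : FiniteEpsData F (SU N)} (Φ : α → Prop) (Ψ : β → Prop)
    (hΦ : ∃ (θ : Stage13Params F N) (hP : θ.Provisos₁₃Sep F N), Rg F θ ∧ θ.Admissible F N ∧ D = datumOfRecord₁₃Sep F N θ hP ∧ Φ (canon₁₃SepOn F N Rg f θ hP))
    (hΨ : ∃ (θ : Stage13Params F N) (hP : θ.Provisos₁₃Sep F N), Rg F θ ∧ θ.Admissible F N ∧ D = datumOfRecord₁₃Sep F N θ hP ∧ Ψ (canon₁₃SepOn F N Rg g θ hP)) :
    ∃ h : IsDatumOfRecord₁₃CSepOn F N Rg D, Φ (f h.params h.provisos) ∧ Ψ (g h.params h.provisos) := by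
  obtain ⟨h, h₁⟩ := (exists_keyed_canon₁₃SepOn_iff Φ).1 hΦ
  obtain ⟨h', h₂⟩ := (exists_keyed_canon₁₃SepOn_iff Ψ).1 hΨ
  exact ⟨h, h₁, h₂⟩

end CanonOn

/-! ## §7. THE GUARD OF RECORD «partition of unity ∧ non-degenerate present slots» and the CN instances

The route's Stage-13 items (rev 16, to be minted) bundle `θ.ZtUnity F N` (print's partition of unity for the residual 𝐓-weights, [Balaban1988Convergent] (3.16)–(3.20)) and
`θ.SlotsNondegenerate₁₃ F N` (no present slot of record is the zero density, (3.22)) into ONE conjunction on the datum's own parameter.  Named once as a regime; the «CN key» is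
§4–§6 at that regime. -/

section Guard

variable (F : T4Family) (N : ℕ) [NeZero N]

/-- **THE CN KEY — «`D` is a datum of record, Stage 13, realised by an admissible tuple WITH print's partition of unity AND non-degenerate present slots»**: the datum key
at the guard of record. [cite: Balaban1989LargeFieldII, Thm 1 + (0.1) pp.355–356; Balaban1988Convergent, (3.16)–(3.22) pp.268–269 (objects of record; bookkeeping)] -/
abbrev IsDatumOfRecord₁₃CSepN (D : FiniteEpsData F (SU N)) : Prop :=
  IsDatumOfRecord₁₃CSepOn F N (unityNondeg₁₃ N) D

/-- **THE CN RECORD CLASS** at the guard of record. [cite: Balaban1989LargeFieldII, Thm 1 + (0.1) pp.355–356; Balaban1988Convergent, (3.16)–(3.22) pp.268–269 (objects of record; bookkeeping)] -/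
abbrev IsRecordOfRecord₁₃CSepN (D : FiniteEpsData F (SU N)) (w : WorldP) : Prop :=
  IsRecordOfRecord₁₃CSepOn F N (unityNondeg₁₃ N) D w

/-- **The CN key, literally**: SOME Stage-13 parameter tuple with provisos, `(θ.ZtUnity F N ∧ θ.SlotsNondegenerate₁₃ F N)`, admissible, has `D` as its datum of record (`Iff.rfl`).
[cite: Balaban1989LargeFieldII, Thm 1 + (0.1) pp.355–356; Balaban1988Convergent, (3.16)–(3.22) pp.268–269 (bookkeeping)] -/
theorem isDatumOfRecord₁₃CSepN_iff (D : FiniteEpsData F (SU N)) :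
    IsDatumOfRecord₁₃CSepN F N D ↔
      ∃ (θ : Stage13Params F N) (h : θ.Provisos₁₃Sep F N), (θ.ZtUnity F N ∧ θ.SlotsNondegenerate₁₃ F N) ∧ θ.Admissible F N ∧ D = datumOfRecord₁₃Sep F N θ h :=
  Iff.rfl

/-- **The CN record class, literally** (`Iff.rfl`). [cite: Balaban1989LargeFieldII, Thm 1 + (0.1) pp.355–356 (bookkeeping)] -/
theorem isRecordOfRecord₁₃CSepN_iff (D : FiniteEpsData F (SU N)) (w : WorldP) :
    IsRecordOfRecord₁₃CSepN F N D w ↔ ∃ θ : Stage13Params F N, (θ.ZtUnity F N ∧ θ.SlotsNondegenerate₁₃ F N) ∧ IsRateKey₁₃Sep F N D w θ :=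
  Iff.rfl

/-- Intro at a guarded admissible tuple with provisos. [cite: Balaban1989LargeFieldII, Thm 1 + (0.1) pp.355–356 (bookkeeping)] -/
theorem isDatumOfRecord₁₃CSepN_datumOfRecord₁₃Sep (θ : Stage13Params F N) (h : θ.Provisos₁₃Sep F N) (hG : θ.ZtUnity F N ∧ θ.SlotsNondegenerate₁₃ F N) (hθ : θ.Admissible F N) :
    IsDatumOfRecord₁₃CSepN F N (datumOfRecord₁₃Sep F N θ h) :=
  isDatumOfRecord₁₃CSepOn_datumOfRecord₁₃Sep F N _ θ h hG hθ

/-- **K0′ READS THE SAME AT THE CN DATUM**: some CN datum of record exists at `(F, N)` iff SOME Stage-13 parameter tuple satisfies every displayed proviso, print's partition of unity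
and non-degeneracy of the present slots, and is admissible — the body of the route's `Record12Inhabited` (rev 15) at `(F, N)`, verbatim; inhabitation is NOT claimed here.
[cite: Balaban1988Convergent, (2.7) p.255, (2.21) p.258, (2.28) p.259, (3.16)–(3.22) pp.268–269; Balaban1987RG1, (1.12)–(1.15) p.262 (hypothesis dictionary; bookkeeping)] -/
theorem exists_isDatumOfRecord₁₃CSepN_iff_exists_params :
    (∃ D : FiniteEpsData F (SU N), IsDatumOfRecord₁₃CSepN F N D) ↔
      ∃ θ : Stage13Params F N, θ.Provisos₁₃Sep F N ∧ (θ.ZtUnity F N ∧ θ.SlotsNondegenerate₁₃ F N) ∧ θ.Admissible F N :=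
  exists_isDatumOfRecord₁₃CSepOn_iff_exists_params F N _

/-- … and iff some CN record exists. [cite: Balaban1989LargeFieldII, Thm 1 + (0.1) pp.355–356 (bookkeeping)] -/
theorem exists_isRecordOfRecord₁₃CSepN_iff_exists_params :
    (∃ (D : FiniteEpsData F (SU N)) (w : WorldP), IsRecordOfRecord₁₃CSepN F N D w) ↔
      ∃ θ : Stage13Params F N, θ.Provisos₁₃Sep F N ∧ (θ.ZtUnity F N ∧ θ.SlotsNondegenerate₁₃ F N) ∧ θ.Admissible F N :=
  (exists_isDatumOfRecord₁₃CSepOn_iff_exists_record F N _).symm.trans (exists_isDatumOfRecord₁₃CSepN_iff_exists_params F N)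

/-- **THE K2′ ∕ K3′ JUNCTION**: a world-blind property at EVERY CN record ⟺ the θ-keyed sentence «`∀ θ (h : θ.Provisos₁₃Sep F N), (θ.ZtUnity F N ∧ θ.SlotsNondegenerate₁₃ F N) →
θ.Admissible F N → P (datumOfRecord₁₃Sep F N θ h)`» — the items' binder prefix (what a `Spine` ∕ endpoint composer over the CN record class reads the text off).
[cite: Balaban1989LargeFieldII, Thm 1 + (0.1) pp.355–356 (bookkeeping)] -/
theorem forall_isRecordOfRecord₁₃CSepN_iff (P : FiniteEpsData F (SU N) → Prop) :
    (∀ (D : FiniteEpsData F (SU N)) (w : WorldP), IsRecordOfRecord₁₃CSepN F N D w → P D) ↔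
      ∀ (θ : Stage13Params F N) (h : θ.Provisos₁₃Sep F N), (θ.ZtUnity F N ∧ θ.SlotsNondegenerate₁₃ F N) → θ.Admissible F N → P (datumOfRecord₁₃Sep F N θ h) :=
  forall_isRecordOfRecord₁₃CSepOn_iff F N _ P

/-- … datum-level form. [cite: Balaban1989LargeFieldII, Thm 1 + (0.1) pp.355–356 (bookkeeping)] -/
theorem forall_isDatumOfRecord₁₃CSepN_iff (P : FiniteEpsData F (SU N) → Prop) :
    (∀ D : FiniteEpsData F (SU N), IsDatumOfRecord₁₃CSepN F N D → P D) ↔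
      ∀ (θ : Stage13Params F N) (h : θ.Provisos₁₃Sep F N), (θ.ZtUnity F N ∧ θ.SlotsNondegenerate₁₃ F N) → θ.Admissible F N → P (datumOfRecord₁₃Sep F N θ h) :=
  forall_isDatumOfRecord₁₃CSepOn_iff F N _ P

/-- Every guarded admissible θ with provisos is a CN record at some world with any window `0 < γw ≤ θ.γ`. [cite: Balaban1989LargeFieldII, Thm 1 + (0.1) pp.355–356 (bookkeeping)] -/
theorem exists_world_isRecordOfRecord₁₃CSepN (θ : Stage13Params F N) (h : θ.Provisos₁₃Sep F N) (hG : θ.ZtUnity F N ∧ θ.SlotsNondegenerate₁₃ F N) (hθ : θ.Admissible F N)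
    {γw : ℝ} (hγw : 0 < γw ∧ γw ≤ θ.γ) : ∃ w : WorldP, IsRecordOfRecord₁₃CSepN F N (datumOfRecord₁₃Sep F N θ h) w ∧ w.γ = γw :=
  exists_world_isRecordOfRecord₁₃CSepOn F N _ θ h hG hθ hγw

variable {F N}
variable {D : FiniteEpsData F (SU N)} {w : WorldP}

/-- **THE GUARD AT THE CANONICAL CN PARAMETER** — the one thing the C key cannot supply. [cite: Balaban1988Convergent, (3.16)–(3.22) pp.268–269 (bookkeeping)] -/
theorem IsDatumOfRecord₁₃CSepN.guard (h : IsDatumOfRecord₁₃CSepN F N D) : h.params.ZtUnity F N ∧ h.params.SlotsNondegenerate₁₃ F N :=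
  h.regime

/-- Print's partition of unity at the canonical CN parameter. [cite: Balaban1988Convergent, (3.16)–(3.20) pp.268–269 (bookkeeping)] -/
theorem IsDatumOfRecord₁₃CSepN.ztUnity (h : IsDatumOfRecord₁₃CSepN F N D) : h.params.ZtUnity F N :=
  h.regime.1

/-- Non-degeneracy of the present slots at the canonical CN parameter. [cite: Balaban1988Convergent, (3.22) p.269 (bookkeeping)] -/
theorem IsDatumOfRecord₁₃CSepN.slotsNondegenerate (h : IsDatumOfRecord₁₃CSepN F N D) : h.params.SlotsNondegenerate₁₃ F N :=
  h.regime.2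

/-- **WHAT A CONSUMER PROVES UNDER THE GUARD ⟹ WHAT THE CN INSTANCE CARRIES** (the items' binder order: guard, then admissibility). [cite: Balaban1989LargeFieldII, Thm 1 p.355 (bookkeeping)] -/
theorem IsDatumOfRecord₁₃CSepN.forall_params {P : (D : FiniteEpsData F (SU N)) → (θ : Stage13Params F N) → θ.Provisos₁₃Sep F N → Prop}
    (hP : ∀ (θ : Stage13Params F N) (hθ : θ.Provisos₁₃Sep F N), (θ.ZtUnity F N ∧ θ.SlotsNondegenerate₁₃ F N) → θ.Admissible F N → P (datumOfRecord₁₃Sep F N θ hθ) θ hθ)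
    (h : IsDatumOfRecord₁₃CSepN F N D) : P D h.params h.provisos :=
  IsDatumOfRecord₁₃CSepOn.forall_params hP h

/-- A CN datum is a C datum (the guard forgotten; its C-canonical parameter is NOT asserted to satisfy the guard). [cite: Balaban1989LargeFieldII, Thm 1 p.355 (bookkeeping)] -/
theorem IsDatumOfRecord₁₃CSepN.isDatumOfRecord₁₃CSep (h : IsDatumOfRecord₁₃CSepN F N D) : IsDatumOfRecord₁₃CSep F N D :=
  h.toC

/-- A CN record is a Stage-13 record. [cite: Balaban1989LargeFieldII, Thm 1 p.355 (bookkeeping)] -/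
theorem IsRecordOfRecord₁₃CSepN.isRecordOfRecord₁₃CSep' (h : IsRecordOfRecord₁₃CSepN F N D w) : IsRecordOfRecord₁₃CSep F N D w :=
  h.isRecordOfRecord₁₃CSep

/-- The guarded tuple behind a CN record (feeds the ₁₃ re-key of `s_R00x_rRec₁₂On_of_regime 𝔯 ·` at `unityNondeg₁₃ N` in one application). [cite: Balaban1989LargeFieldII, Thm 1 + (0.1) pp.355–356 (bookkeeping)] -/
theorem IsRecordOfRecord₁₃CSepN.exists_guarded_tuple (h : IsRecordOfRecord₁₃CSepN F N D w) :
    ∃ (θ : Stage13Params F N) (hP : θ.Provisos₁₃Sep F N), (θ.ZtUnity F N ∧ θ.SlotsNondegenerate₁₃ F N) ∧ θ.Admissible F N ∧ D = datumOfRecord₁₃Sep F N θ hP :=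
  h.exists_regime_tuple

/-- A datum of record whose C-canonical parameter satisfies the guard is a CN datum. [cite: Balaban1989LargeFieldII, Thm 1 p.355 (bookkeeping)] -/
theorem IsDatumOfRecord₁₃CSep.isDatumOfRecord₁₃CSepN_of_guard (h : IsDatumOfRecord₁₃CSep F N D) (hG : h.params.ZtUnity F N ∧ h.params.SlotsNondegenerate₁₃ F N) :
    IsDatumOfRecord₁₃CSepN F N D :=
  h.isDatumOfRecord₁₃CSepOn_of_regime_params hG

end Guard

/-! ## §8. THE ONE-WAY BRIDGE FROM THE ‴ KEYS (`Node00/Record13DatumKey`, strong provisos `Provisos₁₃`): by def-T's `Stage13Params.Provisos₁₃.toSep` and the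
`rfl` agreement of the two data of record, every datum ∕ record keyed on the STRONG provisos is keyed on the GUARDED ones — an inhabitant of a ‴ key inhabits
the ⁗ key; NOT conversely (the guarded `bg` row does not give the strong one). -/

section BridgeFromStrong

variable {F : T4Family} {N : ℕ} [NeZero N]
variable {D : FiniteEpsData F (SU N)} {w : WorldP} {Rg : (F : T4Family) → Stage13Params F N → Prop} {θ : Stage13Params F N}

/-- The θ-exposed key on the strong provisos gives the one on the guarded provisos (same θ). [cite: Balaban1989LargeFieldII, Thm 1 + (0.1) pp.355–356 (bookkeeping)] -/
theorem IsRateKey₁₃.toSep (h : IsRateKey₁₃ F N D w θ) : IsRateKey₁₃Sep F N D w θ := by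
  obtain ⟨hP, hθ, hD, hrest⟩ := h
  exact ⟨hP.toSep, hθ, hD, hrest⟩

/-- A ‴ datum of record is a ⁗ datum of record. [cite: Balaban1989LargeFieldII, Thm 1 + (0.1) pp.355–356 (bookkeeping)] -/
theorem IsDatumOfRecord₁₃C.toSep (h : IsDatumOfRecord₁₃C F N D) : IsDatumOfRecord₁₃CSep F N D := by
  obtain ⟨θ, hP, hθ, hD⟩ := h
  exact ⟨θ, hP.toSep, hθ, hD⟩

/-- … in every regime. [cite: Balaban1989LargeFieldII, Thm 1 + (0.1) pp.355–356 (bookkeeping)] -/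
theorem IsDatumOfRecord₁₃COn.toSep (h : IsDatumOfRecord₁₃COn F N Rg D) : IsDatumOfRecord₁₃CSepOn F N Rg D := by
  obtain ⟨θ, hP, hR, hθ, hD⟩ := h
  exact ⟨θ, hP.toSep, hR, hθ, hD⟩

/-- … and for records in every regime. [cite: Balaban1989LargeFieldII, Thm 1 + (0.1) pp.355–356 (bookkeeping)] -/
theorem IsRecordOfRecord₁₃COn.toSep (h : IsRecordOfRecord₁₃COn F N Rg D w) : IsRecordOfRecord₁₃CSepOn F N Rg D w := by
  obtain ⟨θ, hR, hk⟩ := h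
  exact ⟨θ, hR, hk.toSep⟩

/-- … at the guard of record. [cite: Balaban1988Convergent, (3.16)–(3.22) pp.268–269 (bookkeeping)] -/
theorem IsDatumOfRecord₁₃CN.toSep (h : IsDatumOfRecord₁₃CN F N D) : IsDatumOfRecord₁₃CSepN F N D :=
  IsDatumOfRecord₁₃COn.toSep h

/-- … at the guard of record, records. [cite: Balaban1988Convergent, (3.16)–(3.22) pp.268–269 (bookkeeping)] -/
theorem IsRecordOfRecord₁₃CN.toSep (h : IsRecordOfRecord₁₃CN F N D w) : IsRecordOfRecord₁₃CSepN F N D w :=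
  IsRecordOfRecord₁₃COn.toSep h

end BridgeFromStrong

end Literature.MathematicalPhysics.QuantumFieldTheory.Balaban1983to89.Node00

end
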